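import Summits.KontsevichZagierPeriods.KontsevichZagierPeriods.Theorems.SoloInformedAnDropCurve
import HarnessLib

/-!
# The sign-configuration calculus over `K`: the polar order `κ♯(F, D)` and the measure `μ♯(F, D)`

Solo programme `solo-KontsevichZagierPeriods-informed`, session s111, step (γ-3) of PRES-RAT(2).
The termination measure of the vertex recursion for a boundary germ `F` carrying the
denominator `D` of the integrand:

* `soloInformedKappaDK F D = κ♯(F, D) = ord₀ D(x, φ x)`, the order of `D` along the maximal-contact
  curve `φ` of `F` (for a germ of multiplicity `1`: along its branch), branch-independent
  (`soloInformed_kappaDK_eq_of_branch`);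
* `soloInformedNuDK F D = (ν♯(F), κ♯(F, D))` and the measure
  `soloInformedMuDK F D = μ♯(F, D) = (mult F, ν♯D(F, D) | ν♯D(swap F, swap D) | ⊥)` in
  `ℕ ×ₗ ((ℕ∞ ×ₗ ℕ∞) ×ₗ ℕ∞)`, with its comparison lemmas and the swap symmetry
  `soloInformed_muDK_eq_muDK_swapK` of the swapped pure case;
* the drop lemmas: `soloInformed_muDK_childK_lt_of_pureCone` (multiplicity `≥ 2`: `ν♯` drops, by
  `soloInformed_nuCK_childK_lt`) and `soloInformed_kappaDK_childK_lt` /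
  `soloInformed_muDK_childK_lt_of_multK_one` (multiplicity `1`): if the blow-up chart cancels
  `d − e ≥ 1` powers of the exceptional coordinate from `D ∘ Φ = (κ x)^d · child_D`, i.e. the child
  denominator is `x₀^e · child_D` with `e < d`, then `κ♯(child_F, x₀^e child_D) = κ♯(F, D) − (d − e)
  < κ♯(F, D)` as soon as `κ♯(F, D) < ⊤`; here `ν♯` of a multiplicity-`1` germ is constantly
  `(⊤, 0)` (`soloInformed_nuCK_of_multK_one`).

References: J. Kollár, *Lectures on Resolution of Singularities* (2007), §1.10;
M. Kontsevich, D. Zagier, *Periods* (2001), §1.2.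
-/

noncomputable section

open scoped BigOperators Topology ContDiff
open Filter Polynomial Set

namespace Summit.KontsevichZagierPeriods.KontsevichZagierPeriods.Theorems

variable {K : Type*} [Field K] [Algebra K ℝ]

/-! ### The polar order along the contact curve -/

open Classical in
/-- **The polar order** `κ♯(F, D) = ord₀ D(x, φ x)` along the maximal-contact curve `φ` of `F`
(and `0` if there is none). [this work] -/
def soloInformedKappaDK (F D : MvPolynomial (Fin 2) K) : ℕ∞ :=
  if H : SoloInformedContactOK F then
    analyticOrderAt (fun x => soloInformedEvalR D (x, soloInformedContactCurveK F H x)) 0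
  else 0

/-- **Branch independence of `κ♯`.**  If the maximal-contact polynomial vanishes at `0` and `ψ`
is a continuous branch of it through the origin, then `κ♯(F, D) = ord₀ D(x, ψ x)`. [this work] -/
theorem soloInformed_kappaDK_eq_of_branch {F : MvPolynomial (Fin 2) K} (H : SoloInformedContactOK F)
    (h0 : soloInformedEvalR (soloInformedMaxContactK F) ((0 : ℝ), (0 : ℝ)) = 0) {ψ : ℝ → ℝ}
    (hψ0 : ψ 0 = 0) (hψc : ContinuousAt ψ 0)
    (hψ : ∀ᶠ x in 𝓝 0, soloInformedEvalR (soloInformedMaxContactK F) (x, ψ x) = 0)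
    (D : MvPolynomial (Fin 2) K) :
    soloInformedKappaDK F D = analyticOrderAt (fun x => soloInformedEvalR D (x, ψ x)) 0 := by
  unfold soloInformedKappaDK
  rw [dif_pos H]
  set φ := soloInformedContactCurveK F H with hφ
  have huniq := (soloInformed_contDiffAt_maxContactK F).eventually_apply_eq_iff_implicitFunction
    Literature.Analysis.Calculus.omega_ne_zero H
  have htend : Tendsto (fun x : ℝ => (x, ψ x)) (𝓝 0) (𝓝 ((0 : ℝ), (0 : ℝ))) := by
    have h := (continuous_id.continuousAt (x := (0 : ℝ))).prodMk hψc
    rwa [ContinuousAt, id, hψ0] at h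
  have hev : ∀ᶠ x in 𝓝 (0 : ℝ), φ x = ψ x := by
    filter_upwards [htend.eventually huniq, hψ] with x hx hx'
    rw [h0] at hx
    exact hx.1 hx'
  exact analyticOrderAt_congr (hev.mono fun x hx => by simp only [hx])

/-- Without the contact condition `κ♯ = 0`. [this work] -/
theorem soloInformed_kappaDK_of_not_contactOK {F : MvPolynomial (Fin 2) K}
    (H : ¬ SoloInformedContactOK F) (D : MvPolynomial (Fin 2) K) : soloInformedKappaDK F D = 0 := by
  unfold soloInformedKappaDK; rw [dif_neg H]

/-! ### The measure `μ♯(F, D)` -/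

/-- The pair `(ν♯(F), κ♯(F, D))`, lexicographic. [this work] -/
def soloInformedNuDK (F D : MvPolynomial (Fin 2) K) : (ℕ∞ ×ₗ ℕ∞) ×ₗ ℕ∞ :=
  toLex (soloInformedNuCK F, soloInformedKappaDK F D)

open Classical in
/-- **The termination measure of the vertex recursion**
`μ♯(F, D) = (mult F, (ν♯, κ♯)(F, D) | (ν♯, κ♯)(swap F, swap D) | ⊥)`. [this work] -/
def soloInformedMuDK (F D : MvPolynomial (Fin 2) K) : ℕ ×ₗ ((ℕ∞ ×ₗ ℕ∞) ×ₗ ℕ∞) :=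
  toLex (soloInformedMultK F,
    if soloInformedTopCoeffK F ≠ 0 then soloInformedNuDK F D
    else if soloInformedTopCoeffK (soloInformedSwapK F) ≠ 0 then
      soloInformedNuDK (soloInformedSwapK F) (soloInformedSwapK D)
    else toLex (toLex (0, 0), 0))

/-- The measure when the pure `x₁^m` coefficient is non-zero. [this work] -/
theorem soloInformed_muDK_eq_of_topCoeff_ne {F : MvPolynomial (Fin 2) K}
    (h : soloInformedTopCoeffK F ≠ 0) (D : MvPolynomial (Fin 2) K) :
    soloInformedMuDK F D = toLex (soloInformedMultK F, soloInformedNuDK F D) := by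
  unfold soloInformedMuDK
  rw [if_pos h]

/-- The measure when only the swapped pure coefficient is non-zero. [this work] -/
theorem soloInformed_muDK_eq_of_topCoeff_swapK_ne {F : MvPolynomial (Fin 2) K}
    (h0 : soloInformedTopCoeffK F = 0) (h1 : soloInformedTopCoeffK (soloInformedSwapK F) ≠ 0)
    (D : MvPolynomial (Fin 2) K) :
    soloInformedMuDK F D = toLex (soloInformedMultK F,
      soloInformedNuDK (soloInformedSwapK F) (soloInformedSwapK D)) := by
  unfold soloInformedMuDK
  rw [if_neg (not_not.2 h0), if_pos h1]

/-- A smaller multiplicity gives a smaller measure, whatever the denominators. [this work] -/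
theorem soloInformed_muDK_lt_of_multK_lt {G F : MvPolynomial (Fin 2) K}
    (h : soloInformedMultK G < soloInformedMultK F) (D' D : MvPolynomial (Fin 2) K) :
    soloInformedMuDK G D' < soloInformedMuDK F D := by
  unfold soloInformedMuDK
  rw [Prod.Lex.toLex_lt_toLex]
  exact Or.inl h

/-- Germs of the same multiplicity with non-zero pure coefficients compare by `ν♯` first.
[this work] -/
theorem soloInformed_muDK_lt_of_nuCK_lt {G F : MvPolynomial (Fin 2) K}
    (hm : soloInformedMultK G = soloInformedMultK F)
    (hG : soloInformedTopCoeffK G ≠ 0) (hF : soloInformedTopCoeffK F ≠ 0)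
    (h : soloInformedNuCK G < soloInformedNuCK F) (D' D : MvPolynomial (Fin 2) K) :
    soloInformedMuDK G D' < soloInformedMuDK F D := by
  rw [soloInformed_muDK_eq_of_topCoeff_ne hF, soloInformed_muDK_eq_of_topCoeff_ne hG, hm,
    Prod.Lex.toLex_lt_toLex]
  refine Or.inr ⟨rfl, ?_⟩
  unfold soloInformedNuDK
  rw [Prod.Lex.toLex_lt_toLex]
  exact Or.inl h

/-- Germs of the same multiplicity and the same `ν♯` with non-zero pure coefficients compare by
`κ♯`. [this work] -/
theorem soloInformed_muDK_lt_of_kappaDK_lt {G F : MvPolynomial (Fin 2) K}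
    (hm : soloInformedMultK G = soloInformedMultK F)
    (hG : soloInformedTopCoeffK G ≠ 0) (hF : soloInformedTopCoeffK F ≠ 0)
    (hν : soloInformedNuCK G = soloInformedNuCK F) {D' D : MvPolynomial (Fin 2) K}
    (h : soloInformedKappaDK G D' < soloInformedKappaDK F D) :
    soloInformedMuDK G D' < soloInformedMuDK F D := by
  rw [soloInformed_muDK_eq_of_topCoeff_ne hF, soloInformed_muDK_eq_of_topCoeff_ne hG, hm,
    Prod.Lex.toLex_lt_toLex]
  refine Or.inr ⟨rfl, ?_⟩
  unfold soloInformedNuDK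
  rw [hν, Prod.Lex.toLex_lt_toLex]
  exact Or.inr ⟨rfl, h⟩

/-! ### The swapped pure case -/

/-- **The swapped pure case has the measure of its swap.**  If `cone_F` is not a pure power with
non-negative root but `cone_{swap F} = c (X − θ)^m` (`c ≠ 0`, `θ ≥ 0`), then
`μ♯(F, D) = μ♯(swap F, swap D)`. [this work] -/
theorem soloInformed_muDK_eq_muDK_swapK {F : MvPolynomial (Fin 2) K} {k : ℕ}
    (hmult : soloInformedMultK F = k + 1)
    (h₁ : ∀ c t : K, c ≠ 0 → 0 ≤ algebraMap K ℝ t →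
      soloInformedConePolyK F (k + 1) ≠ C c * (X - C t) ^ (k + 1))
    {c θ : K} (hc : c ≠ 0) (hθ : 0 ≤ algebraMap K ℝ θ)
    (hcone : soloInformedConePolyK (soloInformedSwapK F) (k + 1) = C c * (X - C θ) ^ (k + 1))
    (D : MvPolynomial (Fin 2) K) :
    soloInformedMuDK F D = soloInformedMuDK (soloInformedSwapK F) (soloInformedSwapK D) := by
  have hm := soloInformed_le_deg_of_multK_eq hmult
  have hm₂ := soloInformed_le_deg_swapK hm
  have hmult₂ : soloInformedMultK (soloInformedSwapK F) = k + 1 := by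
    rw [soloInformed_multK_swapK, hmult]
  -- `cone_F` is the reflection of `cone_{swap F}`
  have hrefl : soloInformedConePolyK F (k + 1) = (C c * (X - C θ) ^ (k + 1)).reflect (k + 1) := by
    rw [← hcone, ← soloInformed_conePolyK_swapK _ hm₂, soloInformed_swapK_swapK]
  -- `θ = 0`
  have hθ0 : θ = 0 := by
    by_contra hne
    refine h₁ (c * (-θ) ^ (k + 1)) θ⁻¹ (mul_ne_zero hc (pow_ne_zero _ (neg_ne_zero.2 hne))) ?_ ?_
    · rw [map_inv₀]; exact inv_nonneg.2 hθ
    · rw [hrefl, soloInformed_reflect_pureCone c hne]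
  rw [hθ0, map_zero, sub_zero] at hcone hrefl
  have htopF : soloInformedTopCoeffK F = 0 := by
    unfold soloInformedTopCoeffK
    rw [hmult, ← soloInformed_coeff_conePolyK_self F hm, hrefl, Polynomial.reflect_C_mul_X_pow,
      Polynomial.revAt_le le_rfl, Nat.sub_self, pow_zero, mul_one, Polynomial.coeff_C,
      if_neg (Nat.succ_ne_zero k)]
  have htopS : soloInformedTopCoeffK (soloInformedSwapK F) ≠ 0 := by
    unfold soloInformedTopCoeffK
    rw [hmult₂, ← soloInformed_coeff_conePolyK_self _ hm₂, hcone, Polynomial.coeff_C_mul_X_pow,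
      if_pos rfl]
    exact hc
  rw [soloInformed_muDK_eq_of_topCoeff_swapK_ne htopF htopS,
    soloInformed_muDK_eq_of_topCoeff_ne htopS, hmult, hmult₂]

/-! ### Multiplicity at least two: `ν♯` drops -/

/-- **The measure drops** (multiplicity `k + 1 ≥ 2`, pure cone `c (X − θ)^{k+1}` with non-zero
pure coefficient, finite singular set): every child of the same multiplicity has smaller `μ♯`,
whatever the denominators. [this work] -/
theorem soloInformed_muDK_childK_lt_of_pureCone {F : MvPolynomial (Fin 2) K} {k : ℕ} (hk : 1 ≤ k)
    (hmult : soloInformedMultK F = k + 1) {c θ : K} (hc : c ≠ 0)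
    (hcone : soloInformedConePolyK F (k + 1) = C c * (X - C θ) ^ (k + 1))
    (htop : soloInformedTopCoeffK F ≠ 0) (hsing : (soloInformedSingSet F).Finite)
    {κ lam : K} (hκ : algebraMap K ℝ κ ≠ 0) (hlam : algebraMap K ℝ lam ≠ 0)
    (hmultC : soloInformedMultK (soloInformedChildK F (k + 1) θ κ lam) = k + 1)
    (D' D : MvPolynomial (Fin 2) K) :
    soloInformedMuDK (soloInformedChildK F (k + 1) θ κ lam) D' < soloInformedMuDK F D := by
  have hlamK : lam ≠ 0 := fun h => hlam (by rw [h, map_zero])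
  have htopC : soloInformedTopCoeffK (soloInformedChildK F (k + 1) θ κ lam) ≠ 0 := by
    unfold soloInformedTopCoeffK
    rw [hmultC, soloInformed_coeff_childK_of_pow hcone κ lam]
    exact mul_ne_zero hc (pow_ne_zero _ hlamK)
  exact soloInformed_muDK_lt_of_nuCK_lt (hmultC.trans hmult.symm) htopC htop
    (soloInformed_nuCK_childK_lt hk hmult hc hcone hsing hκ hlam hmultC) D' D

/-! ### Multiplicity one: `κ♯` drops -/

/-- For a germ of multiplicity `1` with `∂₁F(0) ≠ 0` the curve measure is `ν♯(F) = (⊤, 0)`: `F`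
vanishes along its branch and `∂₁F` does not vanish at the origin. [this work] -/
theorem soloInformed_nuCK_of_multK_one {F : MvPolynomial (Fin 2) K}
    (hmult : soloInformedMultK F = 1) (h1 : MvPolynomial.coeff (Finsupp.single 1 1) F ≠ 0) :
    soloInformedNuCK F = toLex (⊤, 0) := by
  have hmult' : soloInformedMultK F = 0 + 1 := by rw [hmult]
  have hmax : soloInformedMaxContactK F = F := by
    rw [soloInformed_maxContactK_eq hmult', Function.iterate_zero_apply]
  have H : SoloInformedContactOK F := soloInformed_contactOK_of_coeff (by rw [hmax]; exact h1)
  obtain ⟨φ, hφan, hφ0, hφev, -, hνF⟩ :=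
    soloInformed_exists_contactCurveC H (soloInformed_evalR_maxContactK_zero hmult')
  rw [hmax] at hφev
  rw [hνF]
  congr 1
  refine Prod.ext ?_ ?_
  · exact analyticOrderAt_eq_top.2 hφev
  · refine (analyticOrderAt_eq_zero (f := fun x => soloInformedEvalR (MvPolynomial.pderiv 1 F)
      (x, φ x)) (z₀ := (0 : ℝ))).2 (Or.inr ?_)
    simp only [hφ0]
    rw [show ((0 : ℝ), (0 : ℝ)) = (0 : ℝ × ℝ) from rfl, soloInformed_evalR_pderiv_zero]
    exact (_root_.map_ne_zero _).2 h1

/-- The value of `x₀^e · Q` at a real point. [this work] -/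
theorem soloInformed_evalR_X_zero_pow_mul (e : ℕ) (Q : MvPolynomial (Fin 2) K) (q : ℝ × ℝ) :
    soloInformedEvalR (MvPolynomial.X 0 ^ e * Q) q = q.1 ^ e * soloInformedEvalR Q q := by
  rw [soloInformed_evalR_apply, soloInformed_evalR_apply, map_mul, map_pow, MvPolynomial.aeval_X,
    Matrix.cons_val_zero]

/-- **The `κ♯` drop.**  Let `F` have multiplicity `1` with cone `c (X − θ)` (`c ≠ 0`), let the
child `child_F(θ, κ, λ)` (`κ, λ ≠ 0`) have multiplicity `1`, and let `D` have all its monomials of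
degree `≥ d`.  If the child denominator is `x₀^e · child_D(θ, κ, λ)` with `e < d` and
`κ♯(F, D) < ⊤`, then `κ♯(child_F, x₀^e child_D) < κ♯(F, D)`. [this work] -/
theorem soloInformed_kappaDK_childK_lt {F : MvPolynomial (Fin 2) K}
    (hmult : soloInformedMultK F = 1) {c θ : K} (hc : c ≠ 0)
    (hcone : soloInformedConePolyK F 1 = C c * (X - C θ) ^ 1)
    {κ lam : K} (hκ : algebraMap K ℝ κ ≠ 0) (hlam : algebraMap K ℝ lam ≠ 0)
    (hmultC : soloInformedMultK (soloInformedChildK F 1 θ κ lam) = 1)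
    {D : MvPolynomial (Fin 2) K} {d e : ℕ} (hmD : ∀ a ∈ D.support, d ≤ a 0 + a 1) (he : e < d)
    (hfin : soloInformedKappaDK F D ≠ ⊤) :
    soloInformedKappaDK (soloInformedChildK F 1 θ κ lam)
        (MvPolynomial.X 0 ^ e * soloInformedChildK D d θ κ lam) <
      soloInformedKappaDK F D := by
  -- notation
  set κ' := algebraMap K ℝ κ with hκ'
  set lam' := algebraMap K ℝ lam with hlam'
  set θ' := algebraMap K ℝ θ with hθ'
  have hlamK : lam ≠ 0 := fun h => hlam (by rw [hlam', h, map_zero])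
  have hκ0 : κ' ≠ 0 := hκ
  have hmult' : soloInformedMultK F = 0 + 1 := by rw [hmult]
  have hmultC' : soloInformedMultK (soloInformedChildK F (0 + 1) θ κ lam) = 0 + 1 := by
    rw [Nat.zero_add]; exact hmultC
  have hmultC1 : soloInformedMultK (soloInformedChildK F 1 θ κ lam) = 0 + 1 := by rw [hmultC]
  have hcone' : soloInformedConePolyK F (0 + 1) = C c * (X - C θ) ^ (0 + 1) := by
    rw [Nat.zero_add]; exact hcone
  have hm := soloInformed_le_deg_of_multK_eq hmult'
  have hm1 : ∀ a ∈ F.support, 1 ≤ a 0 + a 1 := soloInformed_le_deg_of_multK_eq hmult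
  have hmaxF : soloInformedMaxContactK F = F := by
    rw [soloInformed_maxContactK_eq hmult', Function.iterate_zero_apply]
  have hmaxG : soloInformedMaxContactK (soloInformedChildK F 1 θ κ lam) =
      soloInformedChildK F 1 θ κ lam := by
    rw [soloInformed_maxContactK_eq hmultC1, Function.iterate_zero_apply]
  have h0F := soloInformed_evalR_maxContactK_zero hmult'
  have h0G := soloInformed_evalR_maxContactK_zero hmultC1
  have hfac : ((((0 + 1).factorial : ℕ) : ℝ)) * algebraMap K ℝ c ≠ 0 :=
    mul_ne_zero (Nat.cast_ne_zero.2 (Nat.factorial_ne_zero _)) ((_root_.map_ne_zero _).2 hc)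
  -- the branch of `F`
  have HF := soloInformed_contactOK_of_pureCone hmult' hc hcone'
  obtain ⟨φ, hφan, hφ0, hφev, hφder, -⟩ := soloInformed_exists_contactCurveC HF h0F
  have hκF := soloInformed_kappaDK_eq_of_branch HF h0F hφ0 hφan.continuousAt hφev D
  rw [hmaxF] at hφev
  rw [soloInformed_maxContactK_eq hmult'] at hφder
  rw [soloInformed_coeff_single_zero_maxContact_of_pow hm hcone',
    soloInformed_coeff_single_one_maxContact_of_pow hm hcone', map_neg, map_mul, map_mul,
    map_natCast] at hφder
  have hderiv : deriv φ 0 = θ' := by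
    have h1 : ((((0 + 1).factorial : ℕ) : ℝ)) * algebraMap K ℝ c * (deriv φ 0 - θ') = 0 := by
      rw [hθ']; linear_combination hφder
    rcases mul_eq_zero.1 h1 with h2 | h2
    · exact absurd h2 hfac
    · linarith
  obtain ⟨hφ₁an, hφfac, hφ₁0⟩ := soloInformed_dslope_spec hφan hφ0
  set φ₁ := dslope φ 0 with hφ₁def
  rw [hderiv] at hφ₁0
  -- the branch `ψ` of the child
  set ψ : ℝ → ℝ := fun x => (φ₁ (κ' * x) - θ') / lam' with hψdef
  have hψ0 : ψ 0 = 0 := by simp [hψdef, hφ₁0]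
  have hφ₁κ : AnalyticAt ℝ (fun x => φ₁ (κ' * x)) 0 :=
    AnalyticAt.comp_of_eq hφ₁an (analyticAt_const.mul analyticAt_id) (by simp)
  have hψan : AnalyticAt ℝ ψ 0 := (hφ₁κ.sub analyticAt_const).div analyticAt_const (by exact hlam)
  have hkey : ∀ x : ℝ, κ' * x * (θ' + lam' * ψ x) = φ (κ' * x) := fun x => by
    rw [hψdef]
    simp only
    rw [mul_div_cancel₀ _ hlam, add_sub_cancel, hφfac (κ' * x)]
  have htendκ : Tendsto (fun x : ℝ => κ' * x) (𝓝 0) (𝓝 0) := by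
    simpa using (continuous_const_mul κ').tendsto (0 : ℝ)
  have hψbr : ∀ᶠ x in 𝓝 0,
      soloInformedEvalR (soloInformedMaxContactK (soloInformedChildK F 1 θ κ lam)) (x, ψ x) = 0 := by
    filter_upwards [htendκ.eventually hφev] with x hx
    by_cases hx0 : x = 0
    · rw [hx0, hψ0]; exact h0G
    · rw [hmaxG]
      have hval := soloInformed_pow_mul_evalR_childK F hm1 θ κ lam x (ψ x)
      rw [pow_one, ← hκ', ← hθ', ← hlam', hkey x, hx] at hval
      rcases mul_eq_zero.1 hval with h1 | h1
      · exact absurd h1 (mul_ne_zero hκ0 hx0)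
      · exact h1
  have HG : SoloInformedContactOK (soloInformedChildK F 1 θ κ lam) := by
    have h := soloInformed_contactOK_childK_of_pureCone hc hcone' hlamK hmultC'
    rw [Nat.zero_add] at h
    exact h
  have hκG := soloInformed_kappaDK_eq_of_branch HG h0G hψ0 hψan.continuousAt hψbr
    (MvPolynomial.X 0 ^ e * soloInformedChildK D d θ κ lam)
  -- the orders along the branches
  set JD : ℝ → ℝ := fun s => soloInformedEvalR D (s, φ s) with hJDdef
  set JC : ℝ → ℝ := fun x => soloInformedEvalR (soloInformedChildK D d θ κ lam) (x, ψ x)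
    with hJCdef
  have hJDan : AnalyticAt ℝ JD 0 := (soloInformed_analyticAt_evalR D _).comp₂ analyticAt_id hφan
  have hJCan : AnalyticAt ℝ JC 0 :=
    (soloInformed_analyticAt_evalR (soloInformedChildK D d θ κ lam) _).comp₂ analyticAt_id hψan
  have hrel : (fun x : ℝ => (κ' * x) ^ d) * JC = fun x => JD (κ' * x) := by
    funext x
    simp only [Pi.mul_apply, hJCdef, hJDdef]
    rw [← hkey x]
    exact soloInformed_pow_mul_evalR_childK D hmD θ κ lam x (ψ x)
  have hpowan : AnalyticAt ℝ (fun x : ℝ => (κ' * x) ^ d) 0 :=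
    (analyticAt_const.mul analyticAt_id).pow d
  have hord : (d : ℕ∞) + analyticOrderAt JC 0 = analyticOrderAt JD 0 := by
    rw [← soloInformed_analyticOrderAt_comp_mul JD hκ0, ← hrel, analyticOrderAt_mul hpowan hJCan,
      soloInformed_analyticOrderAt_mul_pow hκ0]
  have hchild : (fun x => soloInformedEvalR (MvPolynomial.X 0 ^ e * soloInformedChildK D d θ κ lam)
      (x, ψ x)) = (fun x : ℝ => ((1 : ℝ) * x) ^ e) * JC := by
    funext x
    simp only [Pi.mul_apply, hJCdef, one_mul]
    exact soloInformed_evalR_X_zero_pow_mul e _ _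
  have hpowan' : AnalyticAt ℝ (fun x : ℝ => ((1 : ℝ) * x) ^ e) 0 :=
    (analyticAt_const.mul analyticAt_id).pow e
  have hord' : analyticOrderAt (fun x => soloInformedEvalR
      (MvPolynomial.X 0 ^ e * soloInformedChildK D d θ κ lam) (x, ψ x)) 0 =
      (e : ℕ∞) + analyticOrderAt JC 0 := by
    rw [hchild, analyticOrderAt_mul hpowan' hJCan, soloInformed_analyticOrderAt_mul_pow one_ne_zero]
  rw [hκG, hκF, hord']
  rw [hκF] at hfin
  obtain ⟨N, hN⟩ := ENat.ne_top_iff_exists.1 hfin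
  have hCtop : analyticOrderAt JC 0 ≠ ⊤ := by
    intro h'
    rw [h', add_top] at hord
    exact hfin hord.symm
  obtain ⟨n, hn⟩ := ENat.ne_top_iff_exists.1 hCtop
  rw [← hn, ← hN] at hord ⊢
  rw [show (d : ℕ∞) + (n : ℕ∞) = ((d + n : ℕ) : ℕ∞) by push_cast; rfl] at hord
  rw [show (e : ℕ∞) + (n : ℕ∞) = ((e + n : ℕ) : ℕ∞) by push_cast; rfl]
  have hdn : d + n = N := by exact_mod_cast hord
  exact Nat.cast_lt.2 (by omega)

/-- **The measure drops** (multiplicity `1`, cone `c (X − θ)`, `κ♯(F, D) < ⊤`): the child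
`child_F(θ, κ, λ)` with denominator `x₀^e child_D` (`e < d ≤ deg` of every monomial of `D`) has
strictly smaller `μ♯`. [this work] -/
theorem soloInformed_muDK_childK_lt_of_multK_one {F : MvPolynomial (Fin 2) K}
    (hmult : soloInformedMultK F = 1) {c θ : K} (hc : c ≠ 0)
    (hcone : soloInformedConePolyK F 1 = C c * (X - C θ) ^ 1)
    {κ lam : K} (hκ : algebraMap K ℝ κ ≠ 0) (hlam : algebraMap K ℝ lam ≠ 0)
    {D : MvPolynomial (Fin 2) K} {d e : ℕ} (hmD : ∀ a ∈ D.support, d ≤ a 0 + a 1) (he : e < d)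
    (hfin : soloInformedKappaDK F D ≠ ⊤) :
    soloInformedMuDK (soloInformedChildK F 1 θ κ lam)
        (MvPolynomial.X 0 ^ e * soloInformedChildK D d θ κ lam) <
      soloInformedMuDK F D := by
  have hm : ∀ a ∈ F.support, 1 ≤ a 0 + a 1 := soloInformed_le_deg_of_multK_eq hmult
  have hlamK : lam ≠ 0 := fun h => hlam (by rw [h, map_zero])
  have hle := soloInformed_multK_childK_le_of_pow hcone hc κ hlamK
  have h1 : MvPolynomial.coeff (Finsupp.single 1 1) F = c := by
    rw [← soloInformed_coeff_conePolyK_self F hm, hcone, pow_one, Polynomial.coeff_C_mul,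
      Polynomial.coeff_sub, Polynomial.coeff_X_one, Polynomial.coeff_C, if_neg one_ne_zero, sub_zero,
      mul_one]
  have htopF : soloInformedTopCoeffK F ≠ 0 := by
    unfold soloInformedTopCoeffK
    rw [hmult, h1]
    exact hc
  rcases Nat.lt_or_ge (soloInformedMultK (soloInformedChildK F 1 θ κ lam)) 1 with hlt | hge
  · exact soloInformed_muDK_lt_of_multK_lt (by rw [hmult]; exact hlt) _ _
  have hmultC : soloInformedMultK (soloInformedChildK F 1 θ κ lam) = 1 := le_antisymm hle hge
  have h1C : MvPolynomial.coeff (Finsupp.single 1 1) (soloInformedChildK F 1 θ κ lam) =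
      c * lam ^ 1 := soloInformed_coeff_childK_of_pow hcone κ lam
  have htopC : soloInformedTopCoeffK (soloInformedChildK F 1 θ κ lam) ≠ 0 := by
    unfold soloInformedTopCoeffK
    rw [hmultC, h1C, pow_one]
    exact mul_ne_zero hc hlamK
  refine soloInformed_muDK_lt_of_kappaDK_lt (hmultC.trans hmult.symm) htopC htopF ?_
    (soloInformed_kappaDK_childK_lt hmult hc hcone hκ hlam hmultC hmD he hfin)
  rw [soloInformed_nuCK_of_multK_one hmultC (by rw [h1C, pow_one]; exact mul_ne_zero hc hlamK),
    soloInformed_nuCK_of_multK_one hmult (by rw [h1]; exact hc)]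

end Summit.KontsevichZagierPeriods.KontsevichZagierPeriods.Theorems
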